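import Literature.NumberTheory.Rogawski1990.ArchChartOrbGBlockDescentsSemireg          -- ★ p850837 STAGE A (LH3-p03 (g4)): `exists_stdBlock_clauses_semireg`; brings ★ (M-UNFOLD) p850544∕p850682, ★ (B-STD) `exists_std_package`, ★ `blockWeights_of_mem_splitChartPlaces`, ★ p850497 `exists_smul_map_block_quotientMeasure`, ★ D4b plumbing
import Literature.MeasureTheory.Group.HaarRightInvariantOfProductDecomposition         -- ★ p850728 (F0P2-p01 (g19)): `exists_isHaarMeasure_isMulRightInvariant_isInvInvariant_centralizer_arch` (the `νM` leg)
import HarnessLib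

/-!
# The BLOCK BINDERS of the real-wall dress at EVERY semiregular point, packaged: `K, eM, Ψ` with `hΨ`, `hγ`, `hmap` and the Haar leg `νM` at `s := gprimeTorus α S p`
# ((G2-MUNFOLD-PACK); Rogawski 1990 §4.12 Lemma 4.12.1, §8.2 p. 122; Folland 1995 §2.6; Deitmar–Echterhoff 2014 Thm. 1.5.3)

Topic `NumberTheory/Rogawski1990`; namespace `Literature.NumberTheory.Rogawski1990`.  THEOREMS ONLY (no `def`, no instance, no notation, no axiom, no named fact, no `sorry`);
kernel lane `--kind proof --supports stmt-HodgeConjecture-24833`.  Cell `pub/hodgecm-mathlib`, crux H413 (`stmt-HodgeConjecture-24833`), F0∕P3c line LH3 (closer stub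
`stub_N9`), LETTER L1 `HcOrbitalFamiliesStatement`, clause (I₂) — brick **(G2-MUNFOLD-PACK)** (LH3-plan (g3) 2026-09-02T09:42:33Z → LH10-p02 (g5); consumer F0P3a-p05 (g20)
(B-INST), spec owner F0P3b-p01 (g16)): the PRODUCER half of the hypothesis-free real-wall statement.

THE MATHEMATICS (pure re-packaging; nothing retyped).  The (B)∕(B∞) dress of the real wall `x_{w₀} = 0` (★ p850625 `continuousOn_orbFamGExt_realWall_descended_of_cutoff`, ★
p850781 `contDiffOn_orbFamGExt_realWall_of_block_of_smooth`) binds, at the descent centre `s`, the block data `eM : Z(s) ≃ₜ* U(J) × R`, `Ψ : Z(s)⧸T♯ ≃ₜ U(J)⧸A` (`T♯ = chartTorusG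
(insert w₀ S)`, `A = torusU J`), `hΨ : Ψ⁻¹⟦b⟧ = ⟦eM⁻¹(b,1)⟧`, the JOINT chart reading `hγ : eM γ♯_c = (hypBlockGL x_c ϑ(c), ρ(c))` (`ϑ, ρ` continuous) and the measure identity
`hmap : Ψ_* (νM ∕ dt♯) = κ • μ`, plus a Haar measure `νM` on `Z(s)` (right- and inversion-invariant).  At `s := gprimeTorus α S p` for ANY semiregular compact-chart wall point `p`
(`p w₀ 0 = p w₀ 2`, `e^{i p w₀ 0} ≠ e^{i p w₀ 1}`, regular elsewhere — exactly what ★ `exists_dock_realWall_of_inRegG` (p850857) delivers as `HcSemireg S w₀ 0 2 p`) ALL of these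
are ★: `K, e′, Ψβ, hΨβ`, `(e′ γ♯_c).1 = hypBlockGL (c w₀ 0) (c w₀ 2)` and `g ∈ T♯ ↔ (e′ g).1 ∈ torusU` by ★ STAGE A `exists_stdBlock_clauses_semireg` (over ★ (M-UNFOLD) torus edition
p850682 + ★ (B-STD) `exists_std_package` + ★ `hTAβ_package_semireg_std`); `ρ(c) := (e′ γ♯_c).2` is continuous (`e′` and the chart are); `hmap` for the target `νU ∕ ρA` on
`U(J) ⧸ torusU` (ANY Haar pair) is ★ p850497 `exists_smul_map_block_quotientMeasure` (block descent of a quotient measure through `e′`, `T♯ ↔ torusU × K`); `νM` is ★ p850728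
(`U(J)` unimodular × `K` closed abelian).  The consumer (F0P3a-p05 (g20)'s (B-INST)) picks `ρA, νU`, reads `hμC` for `νU ∕ ρA` off ★ `exists_measure_quotient_torusU_complex_two_eq_smul_map`
(it is `U(J)`-invariant, finite on compacts, nonzero) and feeds ★ p850625 ∕ ★ p850781 with `hCM`∕`hint` from ★ p850857.
* §1 `chartTorusG_insert_le_centralizer_of_wall` (the `hT` binder: `T♯ ≤ Z(γ_p)`, ★ `gprimeTorus_of_wall` + ★ `chartTorusG_le_centralizer`);
* §2 **`exists_smul_map_quotient_torusU_of_stdBlock`** (binder form over STAGE A's `K e′ Ψβ`: for every Haar `νM` on `Z(s)` and every Haar pair `(ρA, νU)` on `(torusU J, U(J))`,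
  `Ψβ_* ((T♯-quotient of νM)) = κ • (νU ∕ ρA)`, `κ ≠ 0`);
* §3 **`exists_realWall_blockPack`** — THE HEAD: `∃ K eM Ψ, IsClosed K ∧ K abelian ∧ hΨ ∧ hγ ∧ Continuous ρ ∧ ([6β] reading of ρ) ∧ (∃ νM Haar, right-inv, inv-inv) ∧ (∀ νM ρA νU, ∃ κ ≠ 0, hmap)` with the
  conclusion tokens of ★ p850625's `eM Ψ hΨ hγ hmap` binders (`ϑ c := c w₀ 2`, `U := univ`).
HONEST LABEL: HC_CM is proved only modulo the 7 printed citations (2 remaining named inputs: hLiu418 = `stmt-HodgeConjecture-24832`, h413 = `stmt-HodgeConjecture-24833`) until rung 0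
closes; count-neutral (letter-L1 (I₂) binder packaging; no stub closes by this file alone).

## References
* [Rogawski1990] J. D. Rogawski, *Automorphic Representations of Unitary Groups in Three Variables*, Ann. of Math. Stud. 123 (1990), §4.12 Lemma 4.12.1 p. 66 (descent to the
  centraliser `M = U(1,1) × …`), §8.2 pp. 119–124 (the `U(1,1)` block at a wall point, on the compact and on the Cayley chart), §3.6 p. 31.
* [Folland1995] G. B. Folland, *A Course in Abstract Harmonic Analysis* (1995), §2.2, §2.6 Thm. 2.49, (2.52).
* [DeitmarEchterhoff2014] A. Deitmar, S. Echterhoff, *Principles of Harmonic Analysis*, 2nd ed. (2014), Thm. 1.5.3, Cor. 1.5.4.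
* [Shelstad1979] D. Shelstad, *Characters and inner forms of a quasi-split group over ℝ*, Compositio Math. 39 (1979), §4 pp. 22–25.
-/

set_option autoImplicit false

noncomputable section

open MeasureTheory MeasureTheory.Measure Set Topology NumberField NumberField.InfinitePlace Complex
open Literature.MeasureTheory.Group Literature.NumberTheory.Automorphic Literature.NumberTheory.Automorphic.UnitaryGroup
open scoped MatrixGroups Matrix NNReal Classical

namespace Literature.NumberTheory.Rogawski1990

/-! ## §1 The `hT` binder at the wall point -/

section Wall

variable (L : Type) [Field L] [NumberField L] [IsCMField L] (α : Fin 3 → L)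
  (S : Finset {w : InfinitePlace L // IsComplex w}) {w₀ : {w : InfinitePlace L // IsComplex w}} {p : {w : InfinitePlace L // IsComplex w} → Fin 3 → ℝ}

/-- **`T♯ = chartTorusG (insert w₀ S) ≤ Z(γ_p)` at a compact-chart wall point `p w₀ 0 = p w₀ 2`** (`γ_p = gprimeTorus S p` IS a point of the split chart, ★ `gprimeTorus_of_wall`;
★ `chartTorusG_le_centralizer`) — the `hT` binder of ★ p850625 ∕ ★ D4b at `s := gprimeTorus L α S p`. [cite: Shelstad1979, §4 p. 25] [cite: Rogawski1990, §3.6 p. 31] -/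
theorem chartTorusG_insert_le_centralizer_of_wall (hw₀ : w₀ ∉ S) (hsp : w₀ ∈ splitChartPlaces L α) (hp : p w₀ 0 = p w₀ 2) :
    chartTorusG L α (insert w₀ S) ≤ Subgroup.centralizer ({gprimeTorus L α S p} : Set ↥(arch (↥(maximalRealSubfield L)) L (IsCMField.complexConj L) 3 (Matrix.diagonal α))) := by
  rw [gprimeTorus_of_wall L α hw₀ hsp hp]
  exact chartTorusG_le_centralizer L α (insert w₀ S) _

end Wall

/-! ## §2 The `hmap` binder from the standardised block (binder form over STAGE A's outputs) -/

section HMap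

variable (L : Type) [Field L] [NumberField L] [IsCMField L] (α : Fin 3 → L)
  [MeasurableSpace ↥(arch (↥(maximalRealSubfield L)) L (IsCMField.complexConj L) 3 (Matrix.diagonal α))]
  [BorelSpace ↥(arch (↥(maximalRealSubfield L)) L (IsCMField.complexConj L) 3 (Matrix.diagonal α))]
  (S : Finset {w : InfinitePlace L // IsComplex w}) (w₀ : {w : InfinitePlace L // IsComplex w}) (p : {w : InfinitePlace L // IsComplex w} → Fin 3 → ℝ)
  (hTβ : chartTorusG L α (insert w₀ S) ≤ Subgroup.centralizer ({gprimeTorus L α S p} : Set ↥(arch (↥(maximalRealSubfield L)) L (IsCMField.complexConj L) 3 (Matrix.diagonal α))))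
  [MeasurableSpace (↥(Subgroup.centralizer ({gprimeTorus L α S p} : Set ↥(arch (↥(maximalRealSubfield L)) L (IsCMField.complexConj L) 3 (Matrix.diagonal α)))) ⧸
    (chartTorusG L α (insert w₀ S)).subgroupOf (Subgroup.centralizer ({gprimeTorus L α S p} : Set ↥(arch (↥(maximalRealSubfield L)) L (IsCMField.complexConj L) 3 (Matrix.diagonal α)))))]
  [BorelSpace (↥(Subgroup.centralizer ({gprimeTorus L α S p} : Set ↥(arch (↥(maximalRealSubfield L)) L (IsCMField.complexConj L) 3 (Matrix.diagonal α)))) ⧸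
    (chartTorusG L α (insert w₀ S)).subgroupOf (Subgroup.centralizer ({gprimeTorus L α S p} : Set ↥(arch (↥(maximalRealSubfield L)) L (IsCMField.complexConj L) 3 (Matrix.diagonal α)))))]
  [LocallyCompactSpace ↥(Subgroup.centralizer ({gprimeTorus L α S p} : Set ↥(arch (↥(maximalRealSubfield L)) L (IsCMField.complexConj L) 3 (Matrix.diagonal α))))]
  {J : Matrix (Fin 2) (Fin 2) ℂ}
  [MeasurableSpace ↥(unitaryGroupOfForm (starRingEnd ℂ) J)] [BorelSpace ↥(unitaryGroupOfForm (starRingEnd ℂ) J)]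
  [LocallyCompactSpace ↥(unitaryGroupOfForm (starRingEnd ℂ) J)] [SecondCountableTopology ↥(unitaryGroupOfForm (starRingEnd ℂ) J)]
  [MeasurableSpace (↥(unitaryGroupOfForm (starRingEnd ℂ) J) ⧸ torusU (starRingEnd ℂ) J)] [BorelSpace (↥(unitaryGroupOfForm (starRingEnd ℂ) J) ⧸ torusU (starRingEnd ℂ) J)]
  (K : Subgroup ↥(Subgroup.centralizer ({gprimeTorus L α S p} : Set ↥(arch (↥(maximalRealSubfield L)) L (IsCMField.complexConj L) 3 (Matrix.diagonal α)))))
  (hKc : IsClosed (K : Set ↥(Subgroup.centralizer ({gprimeTorus L α S p} : Set ↥(arch (↥(maximalRealSubfield L)) L (IsCMField.complexConj L) 3 (Matrix.diagonal α))))))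
  (hKcomm : ∀ k₁, k₁ ∈ K → ∀ k₂, k₂ ∈ K → k₁ * k₂ = k₂ * k₁)
  (e' : ↥(Subgroup.centralizer ({gprimeTorus L α S p} : Set ↥(arch (↥(maximalRealSubfield L)) L (IsCMField.complexConj L) 3 (Matrix.diagonal α)))) ≃ₜ*
    ↥(unitaryGroupOfForm (starRingEnd ℂ) J) × ↥K)
  (hTAβ : ∀ g : ↥(Subgroup.centralizer ({gprimeTorus L α S p} : Set ↥(arch (↥(maximalRealSubfield L)) L (IsCMField.complexConj L) 3 (Matrix.diagonal α)))),
    g ∈ (chartTorusG L α (insert w₀ S)).subgroupOf (Subgroup.centralizer ({gprimeTorus L α S p} : Set ↥(arch (↥(maximalRealSubfield L)) L (IsCMField.complexConj L) 3 (Matrix.diagonal α)))) ↔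
      (e' g).1 ∈ torusU (starRingEnd ℂ) J)
  (Ψβ : (↥(Subgroup.centralizer ({gprimeTorus L α S p} : Set ↥(arch (↥(maximalRealSubfield L)) L (IsCMField.complexConj L) 3 (Matrix.diagonal α)))) ⧸
      (chartTorusG L α (insert w₀ S)).subgroupOf (Subgroup.centralizer ({gprimeTorus L α S p} : Set ↥(arch (↥(maximalRealSubfield L)) L (IsCMField.complexConj L) 3 (Matrix.diagonal α))))) ≃ₜ
      ↥(unitaryGroupOfForm (starRingEnd ℂ) J) ⧸ torusU (starRingEnd ℂ) J)
  (hΨβ : ∀ b : ↥(unitaryGroupOfForm (starRingEnd ℂ) J), Ψβ.symm (QuotientGroup.mk b) = QuotientGroup.mk (e'.symm (b, 1)))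

include hKc hKcomm hTAβ hΨβ in
/-- **THE `hmap` BINDER OF ★ p850625 FROM THE STANDARDISED BLOCK** (binder form over ★ STAGE A's `K e′ hTAβ Ψβ hΨβ`): for EVERY Haar measure `νM` on `Z(γ_p)` (right invariant) and
EVERY Haar pair `ρA` (inversion invariant) on `torusU J`, `νU` (right invariant) on `U(J)`, there is ONE `κ ≠ 0` with
**`Ψβ_* ((chartTorusG (insert w₀ S))-quotient of νM by the transported dt♯) = κ • (νU ∕ ρA)`** — ★ p850497 `exists_smul_map_block_quotientMeasure` through `e′` (`T♯ ↔ torusU × K`),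
auxiliary Haar measure on the closed abelian `K`. [cite: Folland1995, §2.6 Thm. 2.49, (2.52)] [cite: DeitmarEchterhoff2014, Thm. 1.5.3] [cite: Rogawski1990, §4.12 Lemma 4.12.1 p. 66; §8.2 p. 122] -/
theorem exists_smul_map_quotient_torusU_of_stdBlock
    (νM : Measure ↥(Subgroup.centralizer ({gprimeTorus L α S p} : Set ↥(arch (↥(maximalRealSubfield L)) L (IsCMField.complexConj L) 3 (Matrix.diagonal α))))) [νM.IsHaarMeasure] [νM.IsMulRightInvariant]
    (ρA : Measure ↥(torusU (starRingEnd ℂ) J)) [ρA.IsHaarMeasure] [ρA.IsInvInvariant]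
    (νU : Measure ↥(unitaryGroupOfForm (starRingEnd ℂ) J)) [νU.IsHaarMeasure] [νU.IsMulRightInvariant] :
    ∃ κ : ℝ≥0, κ ≠ 0 ∧
      (haveI := isHaarMeasure_chartHaarG L α (insert w₀ S)
       haveI := isInvInvariant_chartHaarG L α (insert w₀ S)
       haveI := isHaarMeasure_map_subgroupOfEquivOfLe_symm hTβ (chartHaarG L α (insert w₀ S))
       haveI := isInvInvariant_map_subgroupOfEquivOfLe_symm hTβ (chartHaarG L α (insert w₀ S))
      Measure.map Ψβ (quotientMeasure ((chartTorusG L α (insert w₀ S)).subgroupOf (Subgroup.centralizer ({gprimeTorus L α S p} : Set ↥(arch (↥(maximalRealSubfield L)) L (IsCMField.complexConj L) 3 (Matrix.diagonal α)))))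
          (Measure.map (Subgroup.subgroupOfEquivOfLe hTβ).symm (chartHaarG L α (insert w₀ S)))
          (isClosed_subgroupOf_of_isClosed _ _ (isClosed_chartTorusG L α (insert w₀ S))) νM)) =
        κ • quotientMeasure (torusU (starRingEnd ℂ) J) ρA (LineRing.isClosed_torusU_two (starRingEnd ℂ) J) νU := by
  haveI := isHaarMeasure_chartHaarG L α (insert w₀ S)
  haveI := isInvInvariant_chartHaarG L α (insert w₀ S)
  haveI := isHaarMeasure_map_subgroupOfEquivOfLe_symm hTβ (chartHaarG L α (insert w₀ S))
  haveI := isInvInvariant_map_subgroupOfEquivOfLe_symm hTβ (chartHaarG L α (insert w₀ S))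
  -- the ambient instances on `Z(γ_p)`, `U(J)`, `K`
  haveI : SecondCountableTopology ↥(Subgroup.centralizer ({gprimeTorus L α S p} : Set ↥(arch (↥(maximalRealSubfield L)) L (IsCMField.complexConj L) 3 (Matrix.diagonal α)))) :=
    TopologicalSpace.Subtype.secondCountableTopology _
  haveI : LocallyCompactSpace ↥K := hKc.isClosedEmbedding_subtypeVal.locallyCompactSpace
  haveI : SecondCountableTopology ↥K := TopologicalSpace.Subtype.secondCountableTopology _
  letI : MeasurableSpace ↥K := borel _
  haveI : BorelSpace ↥K := ⟨rfl⟩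
  -- an auxiliary Haar measure on the closed abelian `K` (right- and inversion-invariant)
  letI : CommGroup ↥K := { (inferInstance : Group ↥K) with mul_comm := fun x y => Subtype.ext (hKcomm x x.2 y y.2) }
  let νK : Measure ↥K := Measure.haar
  haveI : νK.IsMulRightInvariant := inferInstance
  haveI : νK.IsInvInvariant := IsHaarMeasure.isInvInvariant_of_regular νK
  obtain ⟨c, hc0, hmap, -⟩ := exists_smul_map_block_quotientMeasure e'
    ((chartTorusG L α (insert w₀ S)).subgroupOf (Subgroup.centralizer ({gprimeTorus L α S p} : Set ↥(arch (↥(maximalRealSubfield L)) L (IsCMField.complexConj L) 3 (Matrix.diagonal α)))))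
    (isClosed_subgroupOf_of_isClosed _ _ (isClosed_chartTorusG L α (insert w₀ S))) (torusU (starRingEnd ℂ) J) (LineRing.isClosed_torusU_two (starRingEnd ℂ) J) hTAβ Ψβ hΨβ
    (Measure.map (Subgroup.subgroupOfEquivOfLe hTβ).symm (chartHaarG L α (insert w₀ S))) νM ρA νU νK
  exact ⟨c, hc0, hmap⟩

end HMap

/-! ## §3 The PACK: every block binder of ★ p850625 ∕ ★ p850781 at `s := gprimeTorus α S p`, for every semiregular `p` -/

section Pack

variable (L : Type) [Field L] [NumberField L] [IsCMField L] (α : Fin 3 → L)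
  [MeasurableSpace ↥(arch (↥(maximalRealSubfield L)) L (IsCMField.complexConj L) 3 (Matrix.diagonal α))]
  [BorelSpace ↥(arch (↥(maximalRealSubfield L)) L (IsCMField.complexConj L) 3 (Matrix.diagonal α))]
  (S : Finset {w : InfinitePlace L // IsComplex w}) (w₀ : {w : InfinitePlace L // IsComplex w}) (p : {w : InfinitePlace L // IsComplex w} → Fin 3 → ℝ)
  (hα : ∀ i, α i ≠ 0) (hS : ∀ w, w ∈ S → w ∈ splitChartPlaces L α)
  (hw₀ : w₀ ∉ S) (hsp : w₀ ∈ splitChartPlaces L α) (hp : p w₀ 0 = p w₀ 2) (h01 : Circle.exp (p w₀ 0) ≠ Circle.exp (p w₀ 1))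
  (hreg : ∀ w, w ≠ w₀ → w ∉ S → Function.Injective fun i : Fin 3 => Circle.exp (p w i)) (hregS : ∀ w, w ∈ S → p w 0 ≠ 0)
  [MeasurableSpace (↥(Subgroup.centralizer ({gprimeTorus L α S p} : Set ↥(arch (↥(maximalRealSubfield L)) L (IsCMField.complexConj L) 3 (Matrix.diagonal α)))) ⧸
    (chartTorusG L α (insert w₀ S)).subgroupOf (Subgroup.centralizer ({gprimeTorus L α S p} : Set ↥(arch (↥(maximalRealSubfield L)) L (IsCMField.complexConj L) 3 (Matrix.diagonal α)))))]
  [BorelSpace (↥(Subgroup.centralizer ({gprimeTorus L α S p} : Set ↥(arch (↥(maximalRealSubfield L)) L (IsCMField.complexConj L) 3 (Matrix.diagonal α)))) ⧸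
    (chartTorusG L α (insert w₀ S)).subgroupOf (Subgroup.centralizer ({gprimeTorus L α S p} : Set ↥(arch (↥(maximalRealSubfield L)) L (IsCMField.complexConj L) 3 (Matrix.diagonal α)))))]
  [LocallyCompactSpace ↥(Subgroup.centralizer ({gprimeTorus L α S p} : Set ↥(arch (↥(maximalRealSubfield L)) L (IsCMField.complexConj L) 3 (Matrix.diagonal α))))]
  {J : Matrix (Fin 2) (Fin 2) ℂ} (hJ : J = (StdForm.antidiagonal 2).over ℂ)
  [MeasurableSpace ↥(unitaryGroupOfForm (starRingEnd ℂ) J)] [BorelSpace ↥(unitaryGroupOfForm (starRingEnd ℂ) J)]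
  [LocallyCompactSpace ↥(unitaryGroupOfForm (starRingEnd ℂ) J)] [SecondCountableTopology ↥(unitaryGroupOfForm (starRingEnd ℂ) J)]
  [MeasurableSpace (↥(unitaryGroupOfForm (starRingEnd ℂ) J) ⧸ torusU (starRingEnd ℂ) J)] [BorelSpace (↥(unitaryGroupOfForm (starRingEnd ℂ) J) ⧸ torusU (starRingEnd ℂ) J)]

set_option maxHeartbeats 1600000 in
include hα hS h01 hreg hregS in
/-- **(G2-MUNFOLD-PACK) — THE BLOCK BINDERS OF THE REAL-WALL DRESS AT `s := gprimeTorus α S p`, FOR EVERY SEMIREGULAR `p`.**  `S` admissible, `w₀ ∉ S` a split-chart place,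
`p` on the compact chart's noncompact wall (`p w₀ 0 = p w₀ 2`), semiregular (`e^{i p w₀ 0} ≠ e^{i p w₀ 1}`) and regular elsewhere (`hreg`, `hregS`) — e.g. the `p₁` of ★
`exists_dock_realWall_of_inRegG` (`HcSemireg S w₀ 0 2 p₁`).  Then there are a CLOSED ABELIAN `K ≤ Z(γ_p)`, a block splitting `eM : Z(γ_p) ≃ₜ* U(J) × K` and a homeomorphism
`Ψ : Z(γ_p) ⧸ T♯ ≃ₜ U(J) ⧸ torusU J` (`T♯ = chartTorusG (insert w₀ S)`) with: (`hΨ`) `Ψ⁻¹ ⟦b⟧ = ⟦eM⁻¹ (b, 1)⟧`; (`hγ`, on ALL of the coordinate space, `ϑ c := c w₀ 2`,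
`ρ c := (eM γ♯_c).2`) `eM γ♯_c = (hypBlockGL (c w₀ 0) (c w₀ 2), ρ c)` with `ρ` CONTINUOUS and read in `G′_∞` as `γ_S(update c w₀ (0, c_{w₀,1}, 0))` (★ [6β]); (`νM`) a Haar measure on `Z(γ_p)` that is right- and inversion-invariant EXISTS; (`hmap`) for
every such `νM` and every Haar pair `(ρA, νU)` on `(torusU J, U(J))`, `Ψ_* ((T♯-quotient of νM)) = κ • (νU ∕ ρA)` with `κ ≠ 0` — the `eM Ψ hΨ hγ hmap` binders of ★ p850625
`continuousOn_orbFamGExt_realWall_descended_of_cutoff` ∕ ★ p850781 BY NAME (`hT` := ★ `chartTorusG_insert_le_centralizer_of_wall`; `hμC` for `νU ∕ ρA` by ★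
`exists_measure_quotient_torusU_complex_two_eq_smul_map`).  Sources: ★ STAGE A `exists_stdBlock_clauses_semireg` (★ (M-UNFOLD) p850682, ★ (B-STD)), §2, ★ p850728.
[cite: Rogawski1990, §4.12 Lemma 4.12.1 p. 66; §8.2 p. 122] [cite: Folland1995, §2.6 Thm. 2.49, (2.52)] [cite: DeitmarEchterhoff2014, Thm. 1.5.3] [cite: Shelstad1979, §4 pp. 22–25] -/
theorem exists_realWall_blockPack :
    ∃ (K : Subgroup ↥(Subgroup.centralizer ({gprimeTorus L α S p} : Set ↥(arch (↥(maximalRealSubfield L)) L (IsCMField.complexConj L) 3 (Matrix.diagonal α)))))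
      (eM : ↥(Subgroup.centralizer ({gprimeTorus L α S p} : Set ↥(arch (↥(maximalRealSubfield L)) L (IsCMField.complexConj L) 3 (Matrix.diagonal α)))) ≃ₜ*
        ↥(unitaryGroupOfForm (starRingEnd ℂ) J) × ↥K)
      (Ψ : (↥(Subgroup.centralizer ({gprimeTorus L α S p} : Set ↥(arch (↥(maximalRealSubfield L)) L (IsCMField.complexConj L) 3 (Matrix.diagonal α)))) ⧸
          (chartTorusG L α (insert w₀ S)).subgroupOf (Subgroup.centralizer ({gprimeTorus L α S p} : Set ↥(arch (↥(maximalRealSubfield L)) L (IsCMField.complexConj L) 3 (Matrix.diagonal α))))) ≃ₜ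
          ↥(unitaryGroupOfForm (starRingEnd ℂ) J) ⧸ torusU (starRingEnd ℂ) J),
      IsClosed (K : Set ↥(Subgroup.centralizer ({gprimeTorus L α S p} : Set ↥(arch (↥(maximalRealSubfield L)) L (IsCMField.complexConj L) 3 (Matrix.diagonal α))))) ∧
      (∀ k₁, k₁ ∈ K → ∀ k₂, k₂ ∈ K → k₁ * k₂ = k₂ * k₁) ∧
      -- `hΨ`
      (∀ b : ↥(unitaryGroupOfForm (starRingEnd ℂ) J), Ψ.symm (QuotientGroup.mk b) = QuotientGroup.mk (eM.symm (b, 1))) ∧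
      -- `hγ` (with `ϑ c = c w₀ 2`, `ρ c = (eM γ♯_c).2`), on the whole coordinate space
      (∀ c ∈ (Set.univ : Set ({w : InfinitePlace L // IsComplex w} → Fin 3 → ℝ)),
        eM ⟨gprimeTorus L α (insert w₀ S) c, chartTorusG_insert_le_centralizer_of_wall L α S hw₀ hsp hp (gprimeTorus_mem_chartTorusG L α (insert w₀ S) c)⟩ =
          ((⟨hypBlockGL (c w₀ 0) (c w₀ 2), hypBlockGL_mem_of_eq_over hJ (c w₀ 0) (c w₀ 2)⟩ : ↥(unitaryGroupOfForm (starRingEnd ℂ) J)),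
            (eM ⟨gprimeTorus L α (insert w₀ S) c, chartTorusG_insert_le_centralizer_of_wall L α S hw₀ hsp hp (gprimeTorus_mem_chartTorusG L α (insert w₀ S) c)⟩).2)) ∧
      -- `ρ` is continuous
      Continuous (fun c : {w : InfinitePlace L // IsComplex w} → Fin 3 → ℝ =>
        (eM ⟨gprimeTorus L α (insert w₀ S) c, chartTorusG_insert_le_centralizer_of_wall L α S hw₀ hsp hp (gprimeTorus_mem_chartTorusG L α (insert w₀ S) c)⟩).2) ∧
      -- `ρ` read in `G′_∞`: the `K`-component of `γ♯_c` is the compact-chart point `γ_S(update c w₀ (0, c_{w₀,1}, 0))` (★ (M-UNFOLD) [6β]; F0P3a-p05's `hρR`)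
      (∀ c : {w : InfinitePlace L // IsComplex w} → Fin 3 → ℝ,
        ((((eM ⟨gprimeTorus L α (insert w₀ S) c, chartTorusG_insert_le_centralizer_of_wall L α S hw₀ hsp hp (gprimeTorus_mem_chartTorusG L α (insert w₀ S) c)⟩).2 : ↥K) :
            ↥(Subgroup.centralizer ({gprimeTorus L α S p} : Set ↥(arch (↥(maximalRealSubfield L)) L (IsCMField.complexConj L) 3 (Matrix.diagonal α))))) : ↥(arch (↥(maximalRealSubfield L)) L (IsCMField.complexConj L) 3 (Matrix.diagonal α))) =
          gprimeTorus L α S (Function.update c w₀ ![0, c w₀ 1, 0])) ∧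
      -- the Haar leg `νM`
      (∃ νM : Measure ↥(Subgroup.centralizer ({gprimeTorus L α S p} : Set ↥(arch (↥(maximalRealSubfield L)) L (IsCMField.complexConj L) 3 (Matrix.diagonal α)))),
        νM.IsHaarMeasure ∧ νM.IsMulRightInvariant ∧ νM.IsInvInvariant) ∧
      -- `hmap` for every Haar `νM` and every Haar pair `(ρA, νU)`
      (∀ (νM : Measure ↥(Subgroup.centralizer ({gprimeTorus L α S p} : Set ↥(arch (↥(maximalRealSubfield L)) L (IsCMField.complexConj L) 3 (Matrix.diagonal α)))))
        [νM.IsHaarMeasure] [νM.IsMulRightInvariant]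
        (ρA : Measure ↥(torusU (starRingEnd ℂ) J)) [ρA.IsHaarMeasure] [ρA.IsInvInvariant]
        (νU : Measure ↥(unitaryGroupOfForm (starRingEnd ℂ) J)) [νU.IsHaarMeasure] [νU.IsMulRightInvariant],
        ∃ κ : ℝ≥0, κ ≠ 0 ∧
          (haveI := isHaarMeasure_chartHaarG L α (insert w₀ S)
           haveI := isInvInvariant_chartHaarG L α (insert w₀ S)
           haveI := isHaarMeasure_map_subgroupOfEquivOfLe_symm (chartTorusG_insert_le_centralizer_of_wall L α S hw₀ hsp hp) (chartHaarG L α (insert w₀ S))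
           haveI := isInvInvariant_map_subgroupOfEquivOfLe_symm (chartTorusG_insert_le_centralizer_of_wall L α S hw₀ hsp hp) (chartHaarG L α (insert w₀ S))
          Measure.map Ψ (quotientMeasure ((chartTorusG L α (insert w₀ S)).subgroupOf (Subgroup.centralizer ({gprimeTorus L α S p} : Set ↥(arch (↥(maximalRealSubfield L)) L (IsCMField.complexConj L) 3 (Matrix.diagonal α)))))
              (Measure.map (Subgroup.subgroupOfEquivOfLe (chartTorusG_insert_le_centralizer_of_wall L α S hw₀ hsp hp)).symm (chartHaarG L α (insert w₀ S)))
              (isClosed_subgroupOf_of_isClosed _ _ (isClosed_chartTorusG L α (insert w₀ S))) νM)) =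
            κ • quotientMeasure (torusU (starRingEnd ℂ) J) ρA (LineRing.isClosed_torusU_two (starRingEnd ℂ) J) νU) := by
  obtain ⟨K, e, φ, e', Ψ, Ψβ, h1, h3, -, -, -, -, -, -, -, h6β, -, -, -, he', h5β, -, hTAβ, -, -, -, hΨβ⟩ :=
    exists_stdBlock_clauses_semireg L α S w₀ p hα hS hw₀ hsp hp h01 hreg hregS hJ (blockWeights_of_mem_splitChartPlaces L α w₀ hsp).2
  refine ⟨K, e', Ψβ, h1, h3, hΨβ, fun c _ => ?_, ?_, fun c => ?_, ?_, fun νM _ _ ρA _ _ νU _ _ => ?_⟩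
  · -- `hγ`: the first component is ★ STAGE A's `(e′ γ♯_c).1 = hypBlockGL (c w₀ 0) (c w₀ 2)` (membership proofs are irrelevant)
    exact Prod.ext (h5β c) rfl
  · -- `ρ` is continuous: `e′` is, and so is the chart `c ↦ γ♯_c` into `Z(γ_p)`
    refine continuous_snd.comp (e'.continuous.comp ?_)
    exact (continuous_gprimeTorus L α (insert w₀ S)).subtype_mk _
  · -- [6β] through `e′ g = (φ (e g).1, (e g).2)`
    rw [he']
    exact h6β c
  · -- the Haar leg (★ p850728; `U(J)` is unimodular)
    obtain ⟨μ₀, hμ₀⟩ : ∃ μ₀ : Measure ↥(unitaryGroupOfForm (starRingEnd ℂ) J), μ₀.IsHaarMeasure := ⟨Measure.haar, inferInstance⟩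
    haveI : μ₀.IsMulRightInvariant := isMulRightInvariant_of_modularCharacterFun_eq_one (modularCharacterFun_eq_one_of_eq_over_antidiagonal_two hJ) μ₀
    exact exists_isHaarMeasure_isMulRightInvariant_isInvInvariant_centralizer_arch (↥(maximalRealSubfield L)) L (IsCMField.complexConj L) 3 (Matrix.diagonal α)
      _ K h1 h3 e' μ₀
  · exact exists_smul_map_quotient_torusU_of_stdBlock L α S w₀ p (chartTorusG_insert_le_centralizer_of_wall L α S hw₀ hsp hp) K h1 h3 e' hTAβ Ψβ hΨβ νM ρA νU

end Pack

end Literature.NumberTheory.Rogawski1990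

end
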